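import Summits.QuantumFields.BalabanUV.Beta.GAN24.FibreDFT

/-!
# `BalabanUV.Beta.GAN24.FibreDFTDictionary` — binder row G-an2-4 / (CONV-C), road P1-fibre, leaf P1-L04a (part 2/2) of the
# `SKELETON-P1` leaf table: PLANCHEREL for the box DFT and the BLOCH DICTIONARY

NOT IN PRINT; OUR PROOF ATTEMPT.  HONEST FRAMING (cell contract, verbatim): «discharging `BetaPertH` makes Bałaban's UV
stability UNCONDITIONAL — a real constructive-QFT result; it is NOT the continuum limit and NOT the Clay problem.»  HONEST
DEPENDENCY (verbatim): «continuum YM on T⁴ ⇐ BetaPertH ∧ nine spine estimates (0/9 proved); BetaPertH ⇐ (D1) ∧ (D4) ∧ CAP+tail;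
G-an2-4 gates asym, D1 and NE2/3/4.»  [folklore] finite Fourier analysis / bookkeeping (no estimate, no cited fact, no wall binder).
NOT summit progress; this leaf discharges nothing of (CONV-C) by itself.

## What is proved (generic `D`, `N ≥ 1`; notation of `GAN24/FibreDFT`: `kFine`, `amp`, `synth`)

* §1 PLANCHEREL at REAL quasi-momentum (`∀ μ, conj (p μ) = p μ`): `Σ_z ‖synth p a z‖² = N^D · Σ_m ‖a m‖²` (`plancherel`), via
  `conj (pw k x) = pw (−k) x` for real `k` (`conj_pw_of_real`, `conj_kFine`) and the box orthogonality `sum_pw_neg_mul_pw_kFine`.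
* §2 THE BLOCH DICTIONARY (every COMPLEX `p`): for box data `v : Idx D N → ℂ` and the Bloch configuration
  `U = BlochFibreMatrix.tens (blochChar p) v`, the fine fields are plane-wave superpositions over the alias lattice with amplitudes
  the box DFT of the box data — `cfgA U κ x = Σ_m ampA p v m κ · pw (kFine p m) x` and `cfgμ U x = Σ_m ampμ p v m · pw (kFine p m) x`
  at EVERY fine point `x ∈ ℤ^D` (`cfgA_tens_blochChar`, `cfgμ_tens_blochChar`; as `Form1`/`Form0` sums of `FibreSymbols.pw1`/`pw0`:
  `cfgA_tens_blochChar_eq_sum`, `cfgμ_tens_blochChar_eq_sum`), the coarse multiplier is the coarse plane wave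
  `cfgφ U κ y = v (inr (inr κ)) · pw p y` (`cfgφ_tens_blochChar`), and conversely the box data are the synthesis of the amplitudes
  (`boxData_inl_eq_sum`, `boxData_inr_eq_sum`).
These are the inputs by name for leaf P1-L04b (EL / G / M / Q rows of `BlochFibreMatrix.resid` on a plane-wave superposition, via the
`*_plane` symbols of `GAN24/FibreSymbols`).
-/

noncomputable section

open Complex Finset
open scoped BigOperators Real ComplexConjugate
open Literature.Probability.LatticeModels (TorusSite Torus.proj Torus.proj_apply)
open Literature.MathematicalPhysics.QuantumFieldTheory.LatticeForm (IsBloch repZ proj_repZ proj_add_zsmul quo)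
open Literature.MathematicalPhysics.QuantumFieldTheory.Balaban1983to89.Beta
open AffineAveraging (Site Form0 Form1)
open BlochFibreMatrix (Idx Cfg cfgA cfgμ cfgφ tens blochChar blochChar_apply eq_repZ_add_zsmul_quo)
open BlochFibreUniqueness (quo_repZ quo_add_zsmul isBloch_iff)
open Summit.QuantumFields.BalabanUV.Beta.GAN24.FibreSymbols (pw pw0 pw1)
open Summit.QuantumFields.BalabanUV.Beta.GAN24.FibreDFT

namespace Summit.QuantumFields.BalabanUV.Beta.GAN24.FibreDFTDictionary

variable {D N : ℕ} [NeZero N]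

/-! ## §1 Plancherel (real quasi-momentum) -/

omit [NeZero N] in
/-- [folklore] For REAL momenta conjugation reverses the momentum: `conj (pw k x) = pw (−k) x`. -/
theorem conj_pw_of_real {k : Fin D → ℂ} (hk : ∀ μ, conj (k μ) = k μ) (x : Site D) : conj (pw k x) = pw (-k) x := by
  unfold pw
  rw [← Complex.exp_conj]
  congr 1
  rw [map_mul, Complex.conj_I, map_sum]
  simp only [map_mul, map_intCast, hk, Pi.neg_apply, neg_mul, Finset.sum_neg_distrib, mul_neg]

omit [NeZero N] in
/-- [folklore] Real quasi-momenta give real fine momenta. -/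
theorem conj_kFine {p : Fin D → ℂ} (hp : ∀ μ, conj (p μ) = p μ) (m : TorusSite D N) (μ : Fin D) :
    conj (kFine p m μ) = kFine p m μ := by
  simp only [kFine, map_div₀, map_add, map_mul, map_ofNat, Complex.conj_ofReal, map_intCast, map_natCast, hp]

/-- [folklore] **PLANCHEREL** for the twisted box DFT at REAL quasi-momentum: `Σ_z ‖synth p a z‖² = N^D · Σ_m ‖a m‖²`
(equivalently `Σ_z ‖w z‖² = N^D Σ_m ‖amp p w m‖²`, by `synth_amp`). -/
theorem plancherel {p : Fin D → ℂ} (hp : ∀ μ, conj (p μ) = p μ) (a : TorusSite D N → ℂ) :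
    ∑ z : TorusSite D N, ‖synth p a z‖ ^ 2 = (N : ℝ) ^ D * ∑ m : TorusSite D N, ‖a m‖ ^ 2 := by
  have hconj : ∀ z : TorusSite D N, conj (synth p a z) = ∑ m, conj (a m) * pw (-kFine p m) (repZ z) := by
    intro z
    unfold synth
    rw [map_sum]
    refine Finset.sum_congr rfl fun m _ => ?_
    rw [map_mul, conj_pw_of_real (conj_kFine hp m)]
  have key : ∑ z : TorusSite D N, conj (synth p a z) * synth p a z = (N : ℂ) ^ D * ∑ m, conj (a m) * a m := by
    calc ∑ z : TorusSite D N, conj (synth p a z) * synth p a z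
        = ∑ z : TorusSite D N, ∑ m : TorusSite D N, ∑ m' : TorusSite D N,
            conj (a m) * a m' * (pw (-kFine p m) (repZ z) * pw (kFine p m') (repZ z)) := by
          refine Finset.sum_congr rfl fun z _ => ?_
          rw [hconj z]
          unfold synth
          rw [Finset.sum_mul]
          refine Finset.sum_congr rfl fun m _ => ?_
          rw [Finset.mul_sum]
          exact Finset.sum_congr rfl fun m' _ => by ring
      _ = ∑ m : TorusSite D N, ∑ m' : TorusSite D N,
            conj (a m) * a m' * ∑ z : TorusSite D N, pw (-kFine p m) (repZ z) * pw (kFine p m') (repZ z) := by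
          rw [Finset.sum_comm]
          refine Finset.sum_congr rfl fun m _ => ?_
          rw [Finset.sum_comm]
          refine Finset.sum_congr rfl fun m' _ => ?_
          rw [Finset.mul_sum]
      _ = ∑ m : TorusSite D N, ∑ m' : TorusSite D N, conj (a m) * a m' * (if m = m' then (N : ℂ) ^ D else 0) := by
          simp_rw [sum_pw_neg_mul_pw_kFine]
      _ = (N : ℂ) ^ D * ∑ m, conj (a m) * a m := by
          simp_rw [mul_ite, mul_zero]
          rw [Finset.mul_sum]
          refine Finset.sum_congr rfl fun m _ => ?_
          rw [Finset.sum_ite_eq Finset.univ m, if_pos (Finset.mem_univ _)]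
          ring
  have key' : ((∑ z : TorusSite D N, ‖synth p a z‖ ^ 2 : ℝ) : ℂ) = (((N : ℝ) ^ D * ∑ m : TorusSite D N, ‖a m‖ ^ 2 : ℝ) : ℂ) := by
    push_cast
    simp_rw [← Complex.conj_mul']
    exact key
  exact_mod_cast key'

/-! ## §2 THE BLOCH DICTIONARY: the fields of `tens (blochChar p) v` as plane-wave superpositions -/

/-- [folklore] The `A`-amplitudes of box data `v` in direction `κ`: the box DFT of `z ↦ v (inl (κ, z))`. -/
def ampA (p : Fin D → ℂ) (v : Idx D N → ℂ) (m : TorusSite D N) (κ : Fin D) : ℂ :=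
  amp p (fun z => v (Sum.inl (κ, z))) m

/-- [folklore] The `μ`-amplitudes of box data `v`: the box DFT of `z ↦ v (inr (inl z))`. -/
def ampμ (p : Fin D → ℂ) (v : Idx D N → ℂ) (m : TorusSite D N) : ℂ :=
  amp p (fun z => v (Sum.inr (Sum.inl z))) m

/-- [folklore] **BLOCH DICTIONARY, `A`-part, pointwise.**  For the Bloch configuration `U = tens (blochChar p) v` the fine 1-form is the
plane-wave superposition over the alias lattice `cfgA U κ x = Σ_m ampA p v m κ · pw (k_m) x` at EVERY fine point `x ∈ ℤ^D`. -/
theorem cfgA_tens_blochChar (p : Fin D → ℂ) (v : Idx D N → ℂ) (κ : Fin D) (x : Site D) :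
    cfgA (tens (⇑(blochChar p)) v) κ x = ∑ m : TorusSite D N, ampA p v m κ * pw (kFine p m) x := by
  have h1 : cfgA (tens (⇑(blochChar p)) v) κ x = blochChar p (quo N x) * v (Sum.inl (κ, Torus.proj N x)) := rfl
  have h2 : ∀ m : TorusSite D N, ampA p v m κ * pw (kFine p m) x
      = blochChar p (quo N x) * (ampA p v m κ * pw (kFine p m) (repZ (Torus.proj N x))) := by
    intro m
    rw [pw_kFine_site p m x]
    ring
  rw [h1, Finset.sum_congr rfl fun m _ => h2 m, ← Finset.mul_sum]
  congr 1
  have h3 := congrFun (synth_amp p (fun z => v (Sum.inl (κ, z)))) (Torus.proj N x)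
  unfold synth at h3
  exact h3.symm

/-- [folklore] **BLOCH DICTIONARY, `μ`-part, pointwise**: `cfgμ U x = Σ_m ampμ p v m · pw (k_m) x`. -/
theorem cfgμ_tens_blochChar (p : Fin D → ℂ) (v : Idx D N → ℂ) (x : Site D) :
    cfgμ (tens (⇑(blochChar p)) v) x = ∑ m : TorusSite D N, ampμ p v m * pw (kFine p m) x := by
  have h1 : cfgμ (tens (⇑(blochChar p)) v) x = blochChar p (quo N x) * v (Sum.inr (Sum.inl (Torus.proj N x))) := rfl
  have h2 : ∀ m : TorusSite D N, ampμ p v m * pw (kFine p m) x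
      = blochChar p (quo N x) * (ampμ p v m * pw (kFine p m) (repZ (Torus.proj N x))) := by
    intro m
    rw [pw_kFine_site p m x]
    ring
  rw [h1, Finset.sum_congr rfl fun m _ => h2 m, ← Finset.mul_sum]
  congr 1
  have h3 := congrFun (synth_amp p (fun z => v (Sum.inr (Sum.inl z)))) (Torus.proj N x)
  unfold synth at h3
  exact h3.symm

/-- [folklore] **BLOCH DICTIONARY, `A`-part, as `Form1`**: `cfgA U = Σ_m pw1 (k_m) (ampA p v m)` in the currency of `FibreSymbols`. -/
theorem cfgA_tens_blochChar_eq_sum (p : Fin D → ℂ) (v : Idx D N → ℂ) :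
    cfgA (tens (⇑(blochChar p)) v) = ∑ m : TorusSite D N, pw1 (kFine p m) (ampA p v m) := by
  funext κ x
  rw [cfgA_tens_blochChar, Finset.sum_apply, Finset.sum_apply]
  rfl

/-- [folklore] **BLOCH DICTIONARY, `μ`-part, as `Form0`**: `cfgμ U = Σ_m pw0 (k_m) (ampμ p v m)`. -/
theorem cfgμ_tens_blochChar_eq_sum (p : Fin D → ℂ) (v : Idx D N → ℂ) :
    cfgμ (tens (⇑(blochChar p)) v) = ∑ m : TorusSite D N, pw0 (kFine p m) (ampμ p v m) := by
  funext x
  rw [cfgμ_tens_blochChar, Finset.sum_apply]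
  rfl

omit [NeZero N] in
/-- [folklore] **BLOCH DICTIONARY, `φ`-part**: the coarse multiplier is the coarse plane wave `cfgφ U κ y = v (inr (inr κ)) · pw p y`. -/
theorem cfgφ_tens_blochChar (p : Fin D → ℂ) (v : Idx D N → ℂ) (κ : Fin D) (y : Site D) :
    cfgφ (tens (⇑(blochChar p)) v) κ y = v (Sum.inr (Sum.inr κ)) * pw p y := by
  rw [← blochChar_eq_pw, mul_comm]
  rfl

/-- [folklore] INVERSE DICTIONARY: the box data are read off the amplitudes, `v (inl (κ, z)) = Σ_m ampA p v m κ · pw (k_m) (repZ z)`. -/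
theorem boxData_inl_eq_sum (p : Fin D → ℂ) (v : Idx D N → ℂ) (κ : Fin D) (z : TorusSite D N) :
    v (Sum.inl (κ, z)) = ∑ m : TorusSite D N, ampA p v m κ * pw (kFine p m) (repZ z) := by
  have h := congrFun (synth_amp p (fun z => v (Sum.inl (κ, z)))) z
  unfold synth at h
  exact h.symm

/-- [folklore] INVERSE DICTIONARY, `μ`-part: `v (inr (inl z)) = Σ_m ampμ p v m · pw (k_m) (repZ z)`. -/
theorem boxData_inr_eq_sum (p : Fin D → ℂ) (v : Idx D N → ℂ) (z : TorusSite D N) :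
    v (Sum.inr (Sum.inl z)) = ∑ m : TorusSite D N, ampμ p v m * pw (kFine p m) (repZ z) := by
  have h := congrFun (synth_amp p (fun z => v (Sum.inr (Sum.inl z)))) z
  unfold synth at h
  exact h.symm

end Summit.QuantumFields.BalabanUV.Beta.GAN24.FibreDFTDictionary
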